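import Summits.QuantumAdvantage.QuantumAdvantage.Theorems.SosSandwichTransferPBMachineSplit
import HarnessLib

/-!
# Crux `TransferPB` (stmt-QuantumAdvantage-15238, route SosSandwich), line `birth` — the machine half of `stub_pbOracleSimulation`, CORRECTED split

`Theorems/SosSandwichTransferPBMachineSplit.lean` splits the last stub into (Q) `nodeProblem F r c k ∈ PromiseBQP`
and (M) a polynomial-time transcript machine reproducing the advised tree of `derivedAdvisor F x g` for ALL
answer functions `g`. As stated, (M) is UNSATISFIABLE: a deterministic machine making `q(n)` queries cannot
locate a single hidden kept string `s*` among the `2^W − 1` relevant ones when `g` answers every BLOCK test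
`true` and the SINGLE tests `true` only at `s*` (adversary: answer every SINGLE/MEAN query `false`, then plant
`s*` outside the transcript and let the forty MEAN answers at the path `[(s*, false)]` be all `true` resp. all
`false` — same transcript, different threshold bits). The reduction
`stub_pbOracleSimulation_of_bbbvMachines` never needs inconsistent `g`: it quantifies only over answer
functions correct on the promise of `Q = nodeProblem F r c k`, and then the kept sets are polynomially small
(BBBV). This file states the split in the generality the machine builder actually needs:

* `stub_pbOracleSimulation_of_keptMachines` — (Q) plus (M⁺): for every `x` (`n ≥ 1`) and every `g` CONSISTENT
  with `nodeProblem F r c k` the machine's run equals the threshold bit of `advTree Adv D []` for SOME advisor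
  `Adv` that is KEPT-SOUND for `g` (a pick is a free bit whose SINGLE test `g` answers `true`; a refusal
  certifies that no free bit is `Kept`; leaf value `#{j ≤ 40 : MEAN answered true}/40`) and SOME budget
  `D ≥ machineBudget F x r c k` — the advisor's traversal order and the budget formula are the machine's choice;
* `derivedAdvisor_pick_some_kept`, `derivedAdvisor_pick_none_kept` — `derivedAdvisor` is kept-sound (for every `g`);
* `stub_pbOracleSimulation_of_nodeProblem_consistent` — the literal repair of the old split ((M) restricted to
  consistent `g`, any `D ≥ machineBudget`).

All proved; (Q) and (M⁺) are plain `Prop` arguments (D-0026, no named fact).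
Source: S. Aaronson, A. Ambainis, Theory Comput. 10 (2014), proof of Thm. 23 (p. 14); C. H. Bennett,
E. Bernstein, G. Brassard, U. Vazirani, SIAM J. Comput. 26 (1997), Cor. 3.4.
-/

-- D-0017: single-conjunct summit ⇒ the duplicate `QuantumAdvantage.QuantumAdvantage` is mandated.
set_option linter.dupNamespace false

noncomputable section

namespace Summit.QuantumAdvantage.QuantumAdvantage.Cruxes.TransferPB.Birth

open Finset MeasureTheory Literature.Computability.Cryptography Literature.Computability.Complexity
  Literature.Computability.QuantumComplexity Literature.Computability.QuantumComplexity.ClassicalSimulation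
open Summit.QuantumAdvantage.QuantumAdvantage.Theses.SosSandwich
open scoped ENNReal

namespace SimTreePB

section KeptSound

variable {F : QCircuitFamily cliffordT} {x : List Bool} {r : Polynomial ℕ} {c k : ℕ} {g : List Bool → Bool}

/-- A FREE bit whose SINGLE test a consistent `g` answers `true` has magnitude `≥ w/2`. [folklore] -/
theorem halfThreshold_le_bbbvMag_of_single (hgn : ∀ v ∈ (nodeProblem F r c k).no, g v = false)
    {ρ : List (Fin (numOracleBits F x) × Bool)} {s : Fin (numOracleBits F x)}
    (h : g (encSingle F x ρ s) = true) : pbThreshold F x r c k / 2 ≤ bbbvMag F x ρ s := by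
  by_contra hlt
  have hfalse := answer_single_false hgn (not_le.1 hlt).le
  rw [h] at hfalse
  exact Bool.noConfusion hfalse

/-- A FREE bit that is not `Kept` under a consistent `g` has magnitude `< w` (a bit with `m_s ≥ w` makes all its
prefix blocks heavy and passes its single test). [cite: BennettBernsteinBrassardVazirani1997, Cor. 3.4] -/
theorem bbbvMag_lt_of_not_kept (hgy : ∀ v ∈ (nodeProblem F r c k).yes, g v = true)
    {ρ : List (Fin (numOracleBits F x) × Bool)} {s : Fin (numOracleBits F x)} (h : ¬ Kept F x g ρ s) :
    bbbvMag F x ρ s < pbThreshold F x r c k := by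
  by_contra hge
  have hge' : pbThreshold F x r c k ≤ bbbvMag F x ρ s := not_lt.1 hge
  exact h ⟨fun j _ => answer_block_true hgy (hge'.trans (bbbvMag_le_blockMag F x ρ (List.take_prefix j _))),
    answer_single_true hgy hge'⟩

/-- The counted leaf value is `1/20`-accurate under a consistent `g`. [folklore] -/
theorem countVal_accurate (hgy : ∀ v ∈ (nodeProblem F r c k).yes, g v = true)
    (hgn : ∀ v ∈ (nodeProblem F r c k).no, g v = false) (ρ : List (Fin (numOracleBits F x) × Bool)) :
    |(((Icc 1 40).filter fun j => g (encMean F x ρ j) = true).card : ℝ) / 40 -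
        boolAvg (evalBool (restrictPath ρ (acceptPoly F x)))| ≤ 1 / 20 := by
  obtain ⟨h0, h1⟩ := nodeMean_mem F x ρ
  exact thresholdCount_forty h0 h1 (fun j => g (encMean F x ρ j))
    (fun j hj hle => answer_mean_true hgy (mem_Icc.1 hj).1 (mem_Icc.1 hj).2 hle)
    (fun j hj hle => answer_mean_false hgn (mem_Icc.1 hj).1 (mem_Icc.1 hj).2 hle)

/-- `derivedAdvisor`'s picks are free bits whose SINGLE test is answered `true` (for EVERY `g`). [folklore] -/
theorem derivedAdvisor_pick_some_kept {ρ : List (Fin (numOracleBits F x) × Bool)} {s : Fin (numOracleBits F x)}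
    (h : (derivedAdvisor F x g).pick ρ = some s) : s ∉ ρ.map Prod.fst ∧ g (encSingle F x ρ s) = true := by
  classical
  unfold derivedAdvisor at h
  dsimp only at h
  split_ifs at h with hex
  injection h with h
  have hspec := Fin.find_spec (p := fun s => s ∉ ρ.map Prod.fst ∧ Kept F x g ρ s) hex
  rw [h] at hspec
  exact ⟨hspec.1, hspec.2.2⟩

/-- `derivedAdvisor` refuses only when no free bit is `Kept` (for EVERY `g`). [folklore] -/
theorem derivedAdvisor_pick_none_kept {ρ : List (Fin (numOracleBits F x) × Bool)}
    (h : (derivedAdvisor F x g).pick ρ = none) :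
    ∀ s : Fin (numOracleBits F x), s ∉ ρ.map Prod.fst → ¬ Kept F x g ρ s := by
  classical
  intro s hs hkept
  unfold derivedAdvisor at h
  dsimp only at h
  rw [dif_pos ⟨s, hs, hkept⟩] at h
  exact absurd h (Option.some_ne_none _)

/-- `derivedAdvisor`'s leaf value is the MEAN count. [folklore] -/
theorem derivedAdvisor_val_eq (ρ : List (Fin (numOracleBits F x) × Bool)) :
    (derivedAdvisor F x g).val ρ = (((Icc 1 40).filter fun j => g (encMean F x ρ j) = true).card : ℝ) / 40 := rfl

/-- The machine budget is positive. [folklore] -/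
theorem machineBudget_pos : 0 < machineBudget F x r c k := Nat.succ_pos _

/-- The machine budget dominates the budget bound `8T²/((w/2)δ)` of the tree analysis. [folklore] -/
theorem budgetBound_le_machineBudget :
    8 * ((F.circ x.length).oracleQueries : ℝ) ^ 2 /
        (pbThreshold F x r c k / 2 * (1 / (((r.eval x.length : ℕ) : ℝ) + 1))) ≤
      (machineBudget F x r c k : ℝ) := by
  unfold machineBudget
  push_cast
  exact (Nat.le_ceil _).trans (le_add_of_nonneg_right zero_le_one)

end KeptSound

/-! ### The corrected split -/

/-- **`stub_pbOracleSimulation` from (Q) and a kept-sound machine (M⁺).** If (Q) `nodeProblem F r c k ∈ PromiseBQP`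
for all `c, k`, uniform `F`, `r`, and (M⁺) for the same data ONE polynomial-time transcript machine `C` (query
lengths `≤ q(n)`) satisfies: for every input `x` with `n ≥ 1` and every answer function `g` CONSISTENT with
`nodeProblem F r c k` there are an advisor `Adv` and a budget `D ≥ machineBudget F x r c k` such that every pick
of `Adv` is a free bit whose SINGLE test `g` answers `true`, every refusal of `Adv` happens only when no free bit
is `Kept`, the leaf values are the MEAN counts `#{1 ≤ j ≤ 40 : g(MEAN⟨x,ρ,j⟩)}/40`, and `C^{A ⊕ g}(x)` is the
threshold bit of `advTree Adv D []` at the relevant bits of `A` for every `A` — then the registered stub holds.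
(Consistency turns the syntactic clauses into the BBBV-magnitude clauses of
`stub_pbOracleSimulation_of_bbbvMachines`.) [cite: AaronsonAmbainis2014, Thm. 23 (proof, p. 14)] -/
theorem stub_pbOracleSimulation_of_keptMachines
    (hQ : ∀ (c k : ℕ) (F : QCircuitFamily cliffordT), F.IsUniform → ∀ r : Polynomial ℕ,
      nodeProblem F r c k ∈ Literature.Computability.Cryptography.PromiseBQP)
    (hM : ∀ (c k : ℕ) (F : QCircuitFamily cliffordT), F.IsUniform → ∀ r : Polynomial ℕ,
      ∃ (C : OracleAlg Bool) (q : Polynomial ℕ),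
        C.IsPolyTime Computability.encodingBoolBool ∧
        (∀ (O : Oracle) (x : List Bool), ∀ y ∈ C.queries O (q.eval x.length) x, y.length ≤ q.eval x.length) ∧
        ∀ x : List Bool, 1 ≤ x.length → ∀ g : List Bool → Bool,
          (∀ v ∈ (nodeProblem F r c k).yes, g v = true) → (∀ v ∈ (nodeProblem F r c k).no, g v = false) →
          ∃ (Adv : Advisor (numOracleBits F x)) (D : ℕ),
            machineBudget F x r c k ≤ D ∧
            (∀ (ρ : List (Fin (numOracleBits F x) × Bool)) (s : Fin (numOracleBits F x)),
              Adv.pick ρ = some s → s ∉ ρ.map Prod.fst ∧ g (encSingle F x ρ s) = true) ∧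
            (∀ ρ : List (Fin (numOracleBits F x) × Bool), Adv.pick ρ = none →
              ∀ s : Fin (numOracleBits F x), s ∉ ρ.map Prod.fst → ¬ Kept F x g ρ s) ∧
            (∀ ρ : List (Fin (numOracleBits F x) × Bool),
              Adv.val ρ = (((Icc 1 40).filter fun j => g (encMean F x ρ j) = true).card : ℝ) / 40) ∧
            ∀ A : Set (List Bool),
              C.run (Oracle.ofLanguage {w : List Bool | ∃ v : List Bool,
                  (w = false :: v ∧ v ∈ A) ∨ (w = true :: v ∧ g v = true)}) (q.eval x.length) x =
                some (decide (1 / 2 ≤ (advTree Adv D []).eval (oracleBits F x A)))) :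
    Sig.stub_pbOracleSimulation := by
  refine stub_pbOracleSimulation_of_bbbvMachines fun c k F hF r => ?_
  obtain ⟨C, q, hCpoly, hCq, hrun⟩ := hM c k F hF r
  refine ⟨nodeProblem F r c k, hQ c k F hF r, C, q, hCpoly, hCq, fun x hx g hgy hgn => ?_⟩
  obtain ⟨Adv, D, hD, hpick, hnone, hval, hrunA⟩ := hrun x hx g hgy hgn
  refine ⟨Adv, pbThreshold F x r c k / 2, D, half_pos (pbThreshold_pos F x r c k),
    lt_of_lt_of_le machineBudget_pos hD, ?_, ?_, ?_, ?_, hrunA⟩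
  · -- budget
    exact budgetBound_le_machineBudget.trans (by exact_mod_cast hD)
  · -- picks: free, magnitude ≥ w/2
    intro ρ i h
    obtain ⟨hfree, hsingle⟩ := hpick ρ i h
    exact ⟨hfree, halfThreshold_le_bbbvMag_of_single hgn hsingle⟩
  · -- refusals: every free magnitude < w
    intro ρ h i hi
    exact bbbvMag_lt_of_not_kept hgy (hnone ρ h i hi)
  · -- values
    intro ρ
    rw [hval ρ]
    exact countVal_accurate hgy hgn ρ

/-- **The literal repair of `stub_pbOracleSimulation_of_nodeProblem`**: (Q) plus (M') a polynomial-time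
transcript machine whose run with `A ⊕ g` on `x` (`n ≥ 1`) is the threshold bit of
`advTree (derivedAdvisor F x g) D []` for some `D ≥ machineBudget F x r c k`, for every `g` CONSISTENT with
`nodeProblem F r c k` and every `A`. [cite: AaronsonAmbainis2014, Thm. 23 (proof, p. 14)] -/
theorem stub_pbOracleSimulation_of_nodeProblem_consistent
    (hQ : ∀ (c k : ℕ) (F : QCircuitFamily cliffordT), F.IsUniform → ∀ r : Polynomial ℕ,
      nodeProblem F r c k ∈ Literature.Computability.Cryptography.PromiseBQP)
    (hM : ∀ (c k : ℕ) (F : QCircuitFamily cliffordT), F.IsUniform → ∀ r : Polynomial ℕ,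
      ∃ (C : OracleAlg Bool) (q : Polynomial ℕ),
        C.IsPolyTime Computability.encodingBoolBool ∧
        (∀ (O : Oracle) (x : List Bool), ∀ y ∈ C.queries O (q.eval x.length) x, y.length ≤ q.eval x.length) ∧
        ∀ x : List Bool, 1 ≤ x.length → ∀ g : List Bool → Bool,
          (∀ v ∈ (nodeProblem F r c k).yes, g v = true) → (∀ v ∈ (nodeProblem F r c k).no, g v = false) →
          ∃ D : ℕ, machineBudget F x r c k ≤ D ∧
            ∀ A : Set (List Bool),
              C.run (Oracle.ofLanguage {w : List Bool | ∃ v : List Bool,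
                  (w = false :: v ∧ v ∈ A) ∨ (w = true :: v ∧ g v = true)}) (q.eval x.length) x =
                some (decide (1 / 2 ≤
                  (advTree (derivedAdvisor F x g) D []).eval (oracleBits F x A)))) :
    Sig.stub_pbOracleSimulation := by
  refine stub_pbOracleSimulation_of_keptMachines hQ fun c k F hF r => ?_
  obtain ⟨C, q, hCpoly, hCq, hrun⟩ := hM c k F hF r
  refine ⟨C, q, hCpoly, hCq, fun x hx g hgy hgn => ?_⟩
  obtain ⟨D, hD, hrunA⟩ := hrun x hx g hgy hgn
  exact ⟨derivedAdvisor F x g, D, hD, fun ρ s h => derivedAdvisor_pick_some_kept h,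
    fun ρ h => derivedAdvisor_pick_none_kept h, derivedAdvisor_val_eq, hrunA⟩

end SimTreePB

end Summit.QuantumAdvantage.QuantumAdvantage.Cruxes.TransferPB.Birth

end
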